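import Summits.BirchSwinnertonDyer.BirchSwinnertonDyer.Theorems.PrintCf2SplitBadTwoImageAtVEqPointIndex
import Summits.BirchSwinnertonDyer.BirchSwinnertonDyer.Theorems.PrintCf2SplitBadTwoF3LevelLiftInputs
import Summits.BirchSwinnertonDyer.BirchSwinnertonDyer.Theorems.PrintCf2SplitBadTwoF3OfLevelCounts
import Summits.BirchSwinnertonDyer.BirchSwinnertonDyer.Theorems.PrintCf2SplitBadTwoIsotropicLevelSplitting
import Summits.BirchSwinnertonDyer.BirchSwinnertonDyer.Theorems.PrintCf2SplitBadTwoRestrictedSelmerEigenProjector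
import Summits.BirchSwinnertonDyer.BirchSwinnertonDyer.Theorems.SchneiderFreeAdditiveX3PoitouTateSelmerDualityHolds
import HarnessLib

/-!
# Crux `PrintCf2.SplitBadTwoRankOneOfFacts` (stmt-BirchSwinnertonDyer-20368), road α v10.3, S3c input (F3) — hcounts ON THE PLAIN ROAD:
# `hcounts ⟸ (PI) point index ∧ (PIN) pinning at v ∧ (ShaFin) finiteness of Ш(E/K)[2^∞]`

Cell `bsd-print-cf2`, EXTRA WIDTH seat `bsd-line-cf2-p1-w8` g3 (prover-bsd-line-cf2-p1-w8-g3-0); `--supports stmt-BirchSwinnertonDyer-20368`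
(helper, Theses-free). HONEST FRAMING: nothing here closes the crux or a registered stub; BSD is not proved by any of this; no summit
statement is proved by this seat. No definition, no named fact, no `sorry`, no kit. beyond-print theorem: no.

WHAT. After LEAD cut 15 and -w5 g3's `hF3_of_levelCounts` (p678471) the stub S3c hangs on **hcounts** alone. This file is the CUT
**`hcounts_of_pointIndex_of_pinning_of_finiteSha (hPI) (hPIN) (hShaFin) : <hcounts of p678471 VERBATIM>`** on this seat's plain road:
on every S3c frame and for every deep level `2^N`,
`[H¹_𝓖 : H¹_𝓕]` (hcounts' index) `= #range(res_{D_v} | 𝔖_{v̄}(K, W*))` (-w5 g3 p677230 `relIndex_selmerGroup_update_top_eq_natCard_range_resOfLe`)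
`= [E(K_v) : E(K) + 2^N E(K_v)]` (this seat's p680126 `natCard_range_resOfLe_restrictedSelmerBase_eq_index` = p677570 ∘ p678401 ∘ p679115: rank-one
input at finite level, e′-singular vanishing, level lift of the relaxed Kummer group; Poitou–Tate through the tree-discharged
`poitouTate_selmerStructure_duality_holds`) — so `hcounts` follows from three displayed per-frame inputs:
* **(PI)** the POINT INDEX: `v₂ [E(K_v) : E(K) + 2^N E(K_v)] = ℓ + e₃([d]₂)` for `N ≫ 0` (pure local/global points: `E(K) ⊗ ℤ₂ = ℤ₂[π]·P ⊕ tors`,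
  depth of `P` at `v`, `E(K_v)[2^∞]`, `W*(K_v) = W*(K)`; expected `e₃ ≡ 0` — -w2 g11 / -w6 g3 point files);
* **(PIN)** the PINNING at `v` in X11b words, for every equivariant projector `e` onto `W*` killing `W*′` and every level shadow `eN`: (a) the
  `eN`-component of a local Kummer class at `v` is the localised Kummer class of a rational TORSION point; (b) the level lift of the Kummer classes
  of the multiples of `P_K` dies on `D_v` (e-Kummer is torsion at `v`; -w3 g10's `cmScalar_eq_one_sub_of_frame` / (H1″)_v + the κ-bridge);
* **(ShaFin)** `Ш(E/K)[2^∞]` finite (from `Finite 𝔖_{v̄}(K, W*)` + its conjugate + the CM descent of -w8 g2's F2-chain; displayed here).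
Everything else is supplied in the proof: `θ`, `j(W) = −3375`, the places above `2`, the complementary projector `e′` with `e + e′ = 1`, the killing
exponent of `𝔖_{v̄}` (-w5 g3 `exists_forall_pow_nsmul_restrictedSelmerBase_eq_zero`), the Weil datum (`exists_weilPairing_holds`), the isotropic level
splitting (-w4 g9 p677924 `exists_isotropic_levelSplitting_of_frame`), the `ℤ₂`-lines `E(K_v), E(K_{v̄}) ⊇ ℤ₂` (-w7 g3, Silverman VII.6.3) and the
DENSITY scales (p677570 §1), the exponent of `Ш[2^∞]` (p677570 §4).
presearch: all inputs are tree theorems; no new fact.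

References: [MilneADT2006] I Thm. 4.10, §6 Prop. 6.9; [GreenbergLNM1716] §5; [SilvermanAEC2009] Prop. VII.6.3; [Rubin1999] §2; [Agboola2007] §6.
-/

noncomputable section

open scoped Classical

set_option linter.dupNamespace false
set_option autoImplicit false

open CategoryTheory Function Field NumberField IsDedekindDomain WeierstrassCurve
open Literature.NumberTheory.EllipticCurves Literature.NumberTheory.EllipticCurves.GreenbergSelmer
open Literature.NumberTheory.EllipticCurves.Agboola2007
open Literature.NumberTheory.GaloisRepresentations
open Literature.NumberTheory.GaloisRepresentations.DiscreteGaloisModule (SelmerStructure)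
open Literature.NumberTheory.GaloisCohomology
open scoped ContRepresentation
open Summit.BirchSwinnertonDyer.Rank1Residual.X11b
open Summit.BirchSwinnertonDyer.Rank1Residual.X11b.LocBridge
open Summit.BirchSwinnertonDyer.Rank1Residual.X11b.Levels
open Summit.BirchSwinnertonDyer.BirchSwinnertonDyer.Theorems.PrintCf2
open Summit.BirchSwinnertonDyer.BirchSwinnertonDyer.Theorems.PrintCf2.RestrictedSelmerPair
open Summit.BirchSwinnertonDyer.BirchSwinnertonDyer.Theorems.PrintCf2.LevelEigen
open Summit.BirchSwinnertonDyer.BirchSwinnertonDyer.Theorems.PrintCf2.AdditiveAtSeven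
open Summit.BirchSwinnertonDyer.BirchSwinnertonDyer.Theorems.PrintCf2.LocalPointsScalar
open Literature.NumberTheory.GaloisRepresentations (LocalField.adicCompletionPadicAlgebra)

namespace Summit.BirchSwinnertonDyer.BirchSwinnertonDyer.Theorems.PrintCf2.SelmerLocImage

-- `NeZero (2 ^ N)` (X11b `Levels.neZero_pow` with `Fact (Nat.Prime 2)`).
attribute [local instance] Levels.neZero_pow

/-! ## §1. The complementary projector and the local `ℤ₂`-lines -/

section Prelim

variable {F : Type*} [Field F] (V : WeierstrassCurve F) (p : ℕ) [Fact p.Prime] (π : V.endRing) (r r' : ℤ_[p])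

/-- **The complementary projector**: from an equivariant `e : E[p^∞] → W*` with `e|_{W*} = id`, `e|_{W*′} = 0` and `W* + W*′ = E[p^∞]` build
`e′ : E[p^∞] → W*′`, `x ↦ x − e x`, equivariant with `e′|_{W*′} = id` and `e x + e′ x = x`. [cite: Rubin1999, §2] -/
theorem exists_compl_projector (e : V.geomPrimaryTorsion p →+ ↥(V.endEigenPrimaryTorsion p π r))
    (he₁ : ∀ x : ↥(V.endEigenPrimaryTorsion p π r), e x = x)
    (he0 : ∀ x ∈ V.endEigenPrimaryTorsion p π r', e x = 0)
    (he : ∀ (σ : absoluteGaloisGroup F) (x : V.geomPrimaryTorsion p), e (σ • x) = σ • e x)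
    (hsup : V.endEigenPrimaryTorsion p π r ⊔ V.endEigenPrimaryTorsion p π r' = ⊤) :
    ∃ e' : V.geomPrimaryTorsion p →+ ↥(V.endEigenPrimaryTorsion p π r'),
      (∀ x : ↥(V.endEigenPrimaryTorsion p π r'), e' x = x) ∧
      (∀ (σ : absoluteGaloisGroup F) (x : V.geomPrimaryTorsion p), e' (σ • x) = σ • e' x) ∧
      (∀ x, (e x : V.geomPrimaryTorsion p) + (e' x : V.geomPrimaryTorsion p) = x) := by
  have hmem : ∀ x : V.geomPrimaryTorsion p, x - (e x : V.geomPrimaryTorsion p) ∈ V.endEigenPrimaryTorsion p π r' := by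
    intro x
    have hx : x ∈ V.endEigenPrimaryTorsion p π r ⊔ V.endEigenPrimaryTorsion p π r' := hsup ▸ AddSubgroup.mem_top x
    obtain ⟨y, hy, y', hy', rfl⟩ := AddSubgroup.mem_sup.mp hx
    have h1 : (e (y + y') : V.geomPrimaryTorsion p) = y := by
      rw [map_add, he0 y' hy', add_zero]
      exact congrArg Subtype.val (he₁ ⟨y, hy⟩)
    rw [h1, add_sub_cancel_left]
    exact hy'
  refine ⟨{ toFun := fun x ↦ ⟨x - (e x : V.geomPrimaryTorsion p), hmem x⟩
            map_zero' := Subtype.ext (by simp)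
            map_add' := fun x y ↦ Subtype.ext (by
              simp only [map_add, AddSubgroup.coe_add, AddMemClass.mk_add_mk]
              abel) }, fun x ↦ ?_, fun σ x ↦ ?_, fun x ↦ ?_⟩
  · apply Subtype.ext
    change (x : V.geomPrimaryTorsion p) - (e x : V.geomPrimaryTorsion p) = x
    rw [he0 x x.2, ZeroMemClass.coe_zero, sub_zero]
  · apply Subtype.ext
    change σ • x - (e (σ • x) : V.geomPrimaryTorsion p) = σ • (x - (e x : V.geomPrimaryTorsion p))
    rw [he, WeierstrassCurve.endEigenPrimaryTorsion.coe_smul, smul_sub]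
  · change (e x : V.geomPrimaryTorsion p) + (x - (e x : V.geomPrimaryTorsion p)) = x
    abel

end Prelim

/-! ## §2. The cut: `hcounts ⟸ (PI) ∧ (PIN) ∧ (ShaFin)` -/

section Cut

/-- **hcounts ON THE PLAIN ROAD: `hcounts ⟸ (PI) point index ∧ (PIN) pinning at `v` ∧ (ShaFin)`** — the hypothesis `hcounts` of -w5 g3's
`hF3_of_levelCounts` (p678471, hence hF3 of cut 14 and S3c of cut 15) VERBATIM, from three displayed per-frame inputs (module docstring), by
-w5 g3's (P1)-lift `relIndex = #range(res_{D_v} | 𝔖_{v̄})` (p677230) and this seat's `#range = [E(K_v) : E(K) + 2^N E(K_v)]` (p680126 ∘ p679115 ∘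
p678401 ∘ p677570; Poitou–Tate via the tree theorem `poitouTate_selmerStructure_duality_holds`). All CM/frame plumbing (θ, `j = −3375`, the
places above 2, `e′`, the killing exponent, the Weil datum, the isotropic level splitting, the local `ℤ₂`-lines and density scales, the
exponent of `Ш[2^∞]`) is discharged inside. [cite: MilneADT2006, Ch. I, Thm. 4.10(b) and §6 Prop. 6.9] [cite: GreenbergLNM1716, §5]
[cite: SilvermanAEC2009, Prop. VII.6.3] [cite: Rubin1999, §2] [cite: Agboola2007, §6 Prop. 6.10–6.11] -/
theorem hcounts_of_pointIndex_of_pinning_of_finiteSha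
    (hPI : ∃ e₃ : ℤ → ℤ → ℤ, ∀ (d : ℤ), d ≠ 0 → Squarefree d → d % 4 ≠ 1 →
      ∀ (W : WeierstrassCurve ℚ) [W.IsElliptic] [W.IsGloballyMinimal] (C : WeierstrassCurve.VariableChange ℚ),
        C • W = cm7.quadraticTwist (d : ℚ) → W.analyticRank = 1 →
      ∀ (K : Type) [Field K] [NumberField K], IsImaginaryQuadratic K →
      ∀ (v vbar : HeightOneSpectrum (𝓞 K)),
        ((2 : ℕ) : 𝓞 K) ∈ v.asIdeal → ((2 : ℕ) : 𝓞 K) ∈ vbar.asIdeal → vbar ≠ v →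
      ∀ (π : (W.baseChange K).endRing), (π : AddMonoid.End (W.baseChange K).geomPoints) * π = π - 2 →
      ∀ (r : ℤ_[2]), r * r = r - 2 →
        (∀ τ ∈ GreenbergSelmer.inertia v, ∀ x : ↥((W.baseChange K).endEigenPrimaryTorsion 2 π r), τ • x = x ∨ τ • x = -x) →
      ∀ (P : W.toAffine.Point) (c₀ : ℕ) (ℓ : ℤ),
        ¬ IsOfFinAddOrder P →
        (∀ R : W.toAffine.Point, ∃ (k : ℤ) (T : W.toAffine.Point), IsOfFinAddOrder T ∧ R = k • P + T) →
        c₀ ≠ 0 → (W.baseChange ℚ_[2]).IsInReductionKernel (c₀ • W.toPadicPoint 2 P) →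
        ‖(W.baseChange ℚ_[2]).padicLogPoint (c₀ • W.toPadicPoint 2 P) / (c₀ : ℚ_[2])‖ = (2 : ℝ) ^ (-ℓ) →
      Finite (restrictedSelmerBase ↥((W.baseChange K).endEigenPrimaryTorsion 2 π r) 2 vbar) →
      ∃ N₃ : ℕ, ∀ N : ℕ, N₃ ≤ N →
        (padicValNat 2 (((Affine.Point.baseChange (W' := W.baseChange K) K (v.adicCompletion K)).range ⊔
          (zsmulAddGroupHom ((2 ^ N : ℕ) : ℤ) : ((W.baseChange K).baseChange (v.adicCompletion K)).toAffine.Point →+ _).range).index) : ℤ) =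
          ℓ + e₃ (d % 2) ((d / (2 - d % 2)) % 8))
    (hPIN : ∀ (d : ℤ), d ≠ 0 → Squarefree d → d % 4 ≠ 1 →
      ∀ (W : WeierstrassCurve ℚ) [W.IsElliptic] [W.IsGloballyMinimal] (C : WeierstrassCurve.VariableChange ℚ),
        C • W = cm7.quadraticTwist (d : ℚ) → W.analyticRank = 1 →
      ∀ (K : Type) [Field K] [NumberField K], IsImaginaryQuadratic K →
      ∀ (v vbar : HeightOneSpectrum (𝓞 K)),
        ((2 : ℕ) : 𝓞 K) ∈ v.asIdeal → ((2 : ℕ) : 𝓞 K) ∈ vbar.asIdeal → vbar ≠ v →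
      ∀ (π : (W.baseChange K).endRing), (π : AddMonoid.End (W.baseChange K).geomPoints) * π = π - 2 →
      ∀ (r : ℤ_[2]), r * r = r - 2 →
        (∀ τ ∈ GreenbergSelmer.inertia v, ∀ x : ↥((W.baseChange K).endEigenPrimaryTorsion 2 π r), τ • x = x ∨ τ • x = -x) →
      ∀ (P : W.toAffine.Point) (c₀ : ℕ) (ℓ : ℤ),
        ¬ IsOfFinAddOrder P →
        (∀ R : W.toAffine.Point, ∃ (k : ℤ) (T : W.toAffine.Point), IsOfFinAddOrder T ∧ R = k • P + T) →
        c₀ ≠ 0 → (W.baseChange ℚ_[2]).IsInReductionKernel (c₀ • W.toPadicPoint 2 P) →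
        ‖(W.baseChange ℚ_[2]).padicLogPoint (c₀ • W.toPadicPoint 2 P) / (c₀ : ℚ_[2])‖ = (2 : ℝ) ^ (-ℓ) →
      Finite (restrictedSelmerBase ↥((W.baseChange K).endEigenPrimaryTorsion 2 π r) 2 vbar) →
      ∀ (e : (W.baseChange K).geomPrimaryTorsion 2 →+ ↥((W.baseChange K).endEigenPrimaryTorsion 2 π r))
        (he₁ : ∀ x : ↥((W.baseChange K).endEigenPrimaryTorsion 2 π r), e x = x)
        (he0 : ∀ x ∈ (W.baseChange K).endEigenPrimaryTorsion 2 π (1 - r), e x = 0)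
        (he : ∀ (σ : absoluteGaloisGroup K) (x : (W.baseChange K).geomPrimaryTorsion 2), e (σ • x) = σ • e x)
        (N : ℕ) (eN : ((W.baseChange K).torsionGaloisModule ((2 ^ N : ℕ) : ℤ)).toContRepresentation →ⁱL
            ((W.baseChange K).torsionGaloisModule ((2 ^ N : ℕ) : ℤ)).toContRepresentation),
        (∀ y, primaryInclusion (W.baseChange K) 2 N (eN y) =
            (e (primaryInclusion (W.baseChange K) 2 N y) : (W.baseChange K).geomPrimaryTorsion 2)) →
        (∀ c ∈ (W.baseChange K).kummerSelmerStructure ((2 ^ N : ℕ) : ℤ) (Sum.inr v), ∃ T : (W.baseChange K).toAffine.Point,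
            IsOfFinAddOrder T ∧
            galoisCohomology.map (eN.restrictField (Place.Completion (Sum.inr v : Place K))) 1 c =
              galoisCohomology.localization ((W.baseChange K).torsionGaloisModule ((2 ^ N : ℕ) : ℤ)) (Sum.inr v) 1
                (kummerMapTorsion (W.baseChange K) ((2 ^ N : ℕ) : ℤ) ((W.baseChange K).zsmul_geomPoints_surjective_holds (NeZero.ne _)) T)) ∧
        (∀ M : ℤ, resOfLe ↥((W.baseChange K).endEigenPrimaryTorsion 2 π r) (inf_le_left : (⊤ : Subgroup (absoluteGaloisGroup K)) ⊓ decomp v ≤ ⊤)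
            (resH1Hom (Literature.NumberTheory.EllipticCurves.subgroupIncl (⊤ : Subgroup (absoluteGaloisGroup K)))
              (AddMonoidHom.id ↥((W.baseChange K).endEigenPrimaryTorsion 2 π r)) (fun _ _ ↦ rfl)
              (resH1Hom (ContinuousMonoidHom.id (absoluteGaloisGroup K)) e (fun σ m ↦ he σ m)
                (toDiscreteH1 (isOpen_stabilizer_geomPrimaryTorsion (W.baseChange K) 2)
                  (galoisCohomology.map (primaryInclusion (W.baseChange K) 2 N) 1
                    (kummerMapTorsion (W.baseChange K) ((2 ^ N : ℕ) : ℤ) ((W.baseChange K).zsmul_geomPoints_surjective_holds (NeZero.ne _))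
                      (M • Affine.Point.baseChange (W' := W) ℚ K P)))))) = 0))
    (hShaFin : ∀ (d : ℤ), d ≠ 0 → Squarefree d → d % 4 ≠ 1 →
      ∀ (W : WeierstrassCurve ℚ) [W.IsElliptic] [W.IsGloballyMinimal] (C : WeierstrassCurve.VariableChange ℚ),
        C • W = cm7.quadraticTwist (d : ℚ) → W.analyticRank = 1 →
      ∀ (K : Type) [Field K] [NumberField K], IsImaginaryQuadratic K →
      ∀ (v vbar : HeightOneSpectrum (𝓞 K)),
        ((2 : ℕ) : 𝓞 K) ∈ v.asIdeal → ((2 : ℕ) : 𝓞 K) ∈ vbar.asIdeal → vbar ≠ v →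
      ∀ (π : (W.baseChange K).endRing), (π : AddMonoid.End (W.baseChange K).geomPoints) * π = π - 2 →
      ∀ (r : ℤ_[2]), r * r = r - 2 →
        (∀ τ ∈ GreenbergSelmer.inertia v, ∀ x : ↥((W.baseChange K).endEigenPrimaryTorsion 2 π r), τ • x = x ∨ τ • x = -x) →
      ∀ (P : W.toAffine.Point) (c₀ : ℕ) (ℓ : ℤ),
        ¬ IsOfFinAddOrder P →
        (∀ R : W.toAffine.Point, ∃ (k : ℤ) (T : W.toAffine.Point), IsOfFinAddOrder T ∧ R = k • P + T) →
        c₀ ≠ 0 → (W.baseChange ℚ_[2]).IsInReductionKernel (c₀ • W.toPadicPoint 2 P) →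
        ‖(W.baseChange ℚ_[2]).padicLogPoint (c₀ • W.toPadicPoint 2 P) / (c₀ : ℚ_[2])‖ = (2 : ℝ) ^ (-ℓ) →
      Finite (restrictedSelmerBase ↥((W.baseChange K).endEigenPrimaryTorsion 2 π r) 2 vbar) →
      Finite (AddCommGroup.primaryComponent (W.baseChange K).sha 2)) :
    ∃ e₃ : ℤ → ℤ → ℤ, ∀ (d : ℤ), d ≠ 0 → Squarefree d → d % 4 ≠ 1 →
      ∀ (W : WeierstrassCurve ℚ) [W.IsElliptic] [W.IsGloballyMinimal] (C : WeierstrassCurve.VariableChange ℚ),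
        C • W = cm7.quadraticTwist (d : ℚ) → W.analyticRank = 1 →
      ∀ (K : Type) [Field K] [NumberField K], IsImaginaryQuadratic K →
      ∀ (v vbar : HeightOneSpectrum (𝓞 K)),
        ((2 : ℕ) : 𝓞 K) ∈ v.asIdeal → ((2 : ℕ) : 𝓞 K) ∈ vbar.asIdeal → vbar ≠ v →
      ∀ (π : (W.baseChange K).endRing), (π : AddMonoid.End (W.baseChange K).geomPoints) * π = π - 2 →
      ∀ (r : ℤ_[2]), r * r = r - 2 →
        (∀ τ ∈ GreenbergSelmer.inertia v, ∀ x : ↥((W.baseChange K).endEigenPrimaryTorsion 2 π r), τ • x = x ∨ τ • x = -x) →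
      ∀ (P : W.toAffine.Point) (c₀ : ℕ) (ℓ : ℤ),
        ¬ IsOfFinAddOrder P →
        (∀ R : W.toAffine.Point, ∃ (k : ℤ) (T : W.toAffine.Point), IsOfFinAddOrder T ∧ R = k • P + T) →
        c₀ ≠ 0 → (W.baseChange ℚ_[2]).IsInReductionKernel (c₀ • W.toPadicPoint 2 P) →
        ‖(W.baseChange ℚ_[2]).padicLogPoint (c₀ • W.toPadicPoint 2 P) / (c₀ : ℚ_[2])‖ = (2 : ℝ) ^ (-ℓ) →
      Finite (restrictedSelmerBase ↥((W.baseChange K).endEigenPrimaryTorsion 2 π r) 2 vbar) →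
      ∀ (e : (W.baseChange K).geomPrimaryTorsion 2 →+ ↥((W.baseChange K).endEigenPrimaryTorsion 2 π r)),
        (∀ x : ↥((W.baseChange K).endEigenPrimaryTorsion 2 π r), e x = x) →
        (∀ x ∈ (W.baseChange K).endEigenPrimaryTorsion 2 π (1 - r), e x = 0) →
        (∀ (σ : absoluteGaloisGroup K) (x : (W.baseChange K).geomPrimaryTorsion 2), e (σ • x) = σ • e x) →
      ∃ N₁ : ℕ, ∀ N : ℕ, N₁ ≤ N →
        ∃ eN : ((W.baseChange K).torsionGaloisModule ((2 ^ N : ℕ) : ℤ)).toContRepresentation →ⁱL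
            ((W.baseChange K).torsionGaloisModule ((2 ^ N : ℕ) : ℤ)).toContRepresentation,
          (∀ y, primaryInclusion (W.baseChange K) 2 N (eN y) =
            (e (primaryInclusion (W.baseChange K) 2 N y) : (W.baseChange K).geomPrimaryTorsion 2)) ∧
          ∀ 𝓕 : SelmerStructure ((W.baseChange K).torsionGaloisModule ((2 ^ N : ℕ) : ℤ)),
            (∀ w : InfinitePlace K, 𝓕 (Sum.inl w) = ⊤) →
            (∀ w : HeightOneSpectrum (𝓞 K), w ≠ v →
              𝓕 (Sum.inr w) = (galoisCohomology.map ((primaryInclusion (W.baseChange K) 2 N).restrictField (w.adicCompletion K)) 1).ker) →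
            𝓕 (Sum.inr v) = ((galoisCohomology.map ((primaryInclusion (W.baseChange K) 2 N).restrictField (v.adicCompletion K)) 1).ker).comap
              (galoisCohomology.map (eN.restrictField (v.adicCompletion K)) 1) →
            (padicValNat 2 (𝓕.selmerGroup.relIndex (SelmerStructure.selmerGroup (Function.update 𝓕 (Sum.inr v : Place K) ⊤))) : ℤ) =
              ℓ + e₃ (d % 2) ((d / (2 - d % 2)) % 8) := by
  obtain ⟨e₃, hPI⟩ := hPI
  refine ⟨e₃, ?_⟩
  intro d hd0 hsq hd4 W _ _ C hC hrk K _ _ hK v vbar hv hvbar hne π hrel r hr hpinI P c₀ ℓ hP hgen hc₀ hker hlog hfin e he₁ he0 he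
  haveI : Fact (Nat.Prime 2) := ⟨Nat.prime_two⟩
  haveI : IsTotallyComplex K := hK.2
  have hj : W.j = -3375 := j_eq_of_smul_eq_cm7Twist hd0 W C hC
  obtain ⟨θ, hθ⟩ := exists_sq_eq_neg_seven_of_cmEndo_mem_endRing W K hj π hrel
  have hall : ∀ w : HeightOneSpectrum (𝓞 K), ((2 : ℕ) : 𝓞 K) ∈ w.asIdeal → w = v ∨ w = vbar :=
    fun w hw ↦ CMPrimes.eq_or_eq_of_two_mem K hK.1 hv hvbar hne hw
  obtain ⟨-, hsup, -⟩ := CMPrimes.endEigenPrimaryTorsion_two_structure W hj K hθ π hrel hr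
  obtain ⟨e', he'₁, he', hsum⟩ := exists_compl_projector (W.baseChange K) 2 π r (1 - r) e he₁ he0 he hsup
  -- the killing exponent of `𝔖_v̄`
  obtain ⟨N₀, hN₀1, hN₀⟩ := exists_forall_pow_nsmul_restrictedSelmerBase_eq_zero (W.baseChange K) 2 π r vbar hfin
  -- the exponent of `Ш[2^∞]`
  haveI := hShaFin d hd0 hsq hd4 W C hC hrk K hK v vbar hv hvbar hne π hrel r hr hpinI P c₀ ℓ hP hgen hc₀ hker hlog hfin
  obtain ⟨j, hShaj⟩ := exists_sha_inf_torsionBy_le (W.baseChange K) 2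
  -- the rational point over `K`
  have hPK : ¬ IsOfFinAddOrder (Affine.Point.baseChange (W' := W) ℚ K P) := fun h ↦
    hP ((Affine.Point.map_injective (W' := W) (Algebra.ofId ℚ K)).isOfFinAddOrder_iff.mp h)
  -- the `ℤ₂`-line at `v` and the density scale there
  obtain ⟨cv, hcv⟩ : ∃ cv : ℕ, ∀ n N : ℕ, cv ≤ n →
      (zsmulAddGroupHom ((2 ^ n : ℕ) : ℤ) : ((W.baseChange K).baseChange (v.adicCompletion K)).toAffine.Point →+ _).range ≤
        (Affine.Point.baseChange (W' := W.baseChange K) K (v.adicCompletion K)).range ⊔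
          (zsmulAddGroupHom ((2 ^ N : ℕ) : ℤ) : ((W.baseChange K).baseChange (v.adicCompletion K)).toAffine.Point →+ _).range := by
    letI : Algebra ℚ_[2] (v.adicCompletion K) := LocalField.adicCompletionPadicAlgebra v 2 hv
    have h1 : Module.finrank ℚ_[2] (v.adicCompletion K) = 1 := by
      rw [Literature.NumberTheory.NumberFields.finrank_adicCompletionPadicAlgebra_eq 2 v hv]
      exact ramificationIdx_mul_inertiaDeg_eq_one_of_ne hK.1 hv hvbar hne
    haveI : FiniteDimensional ℚ_[2] (v.adicCompletion K) := Module.finite_of_finrank_pos (by rw [h1]; exact one_pos)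
    obtain ⟨U, hU, ⟨eU⟩⟩ := exists_finiteIndex_addEquiv_padicInt_of_finrank_eq_one 2 h1 ((W.baseChange K).baseChange (v.adicCompletion K))
    haveI := hU
    have hPv : ¬ IsOfFinAddOrder (Affine.Point.baseChange (W' := W.baseChange K) K (v.adicCompletion K)
        (Affine.Point.baseChange (W' := W) ℚ K P)) := fun h ↦
      hPK ((Affine.Point.map_injective (W' := W.baseChange K) (Algebra.ofId K (v.adicCompletion K))).isOfFinAddOrder_iff.mp h)
    exact exists_range_zsmul_le_baseChange_sup (W.baseChange K) 2 (v.adicCompletion K) U eU hPv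
  -- the `ℤ₂`-line at `v̄` and the density scale there
  obtain ⟨cb, hcb⟩ : ∃ cb : ℕ, ∀ (N : ℕ) (y : ((W.baseChange K).baseChange (vbar.adicCompletion K)).toAffine.Point),
      ∃ (M : ℤ) (y' : ((W.baseChange K).baseChange (vbar.adicCompletion K)).toAffine.Point),
        2 ^ cb • y = M • Affine.Point.baseChange (W' := W.baseChange K) K (vbar.adicCompletion K)
          (Affine.Point.baseChange (W' := W) ℚ K P) + 2 ^ N • y' := by
    letI : Algebra ℚ_[2] (vbar.adicCompletion K) := LocalField.adicCompletionPadicAlgebra vbar 2 hvbar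
    have h1 : Module.finrank ℚ_[2] (vbar.adicCompletion K) = 1 := by
      rw [Literature.NumberTheory.NumberFields.finrank_adicCompletionPadicAlgebra_eq 2 vbar hvbar]
      exact ramificationIdx_mul_inertiaDeg_eq_one_of_ne hK.1 hvbar hv (Ne.symm hne)
    haveI : FiniteDimensional ℚ_[2] (vbar.adicCompletion K) := Module.finite_of_finrank_pos (by rw [h1]; exact one_pos)
    obtain ⟨U, hU, ⟨eU⟩⟩ := exists_finiteIndex_addEquiv_padicInt_of_finrank_eq_one 2 h1
      ((W.baseChange K).baseChange (vbar.adicCompletion K))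
    haveI := hU
    have hPb : ¬ IsOfFinAddOrder (Affine.Point.baseChange (W' := W.baseChange K) K (vbar.adicCompletion K)
        (Affine.Point.baseChange (W' := W) ℚ K P)) := fun h ↦
      hPK ((Affine.Point.map_injective (W' := W.baseChange K) (Algebra.ofId K (vbar.adicCompletion K))).isOfFinAddOrder_iff.mp h)
    exact exists_pow_nsmul_eq_zsmul_add U eU hPb
  -- the threshold of (PI)
  obtain ⟨N₃, hN₃⟩ := hPI d hd0 hsq hd4 W C hC hrk K hK v vbar hv hvbar hne π hrel r hr hpinI P c₀ ℓ hP hgen hc₀ hker hlog hfin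
  refine ⟨max N₀ (max (j + cv) N₃), fun N hN ↦ ?_⟩
  have hNN₀ : N₀ ≤ N := le_trans (le_max_left _ _) hN
  have hNj : j + cv ≤ N := le_trans (le_trans (le_max_left _ _) (le_max_right _ _)) hN
  have hNN₃ : N₃ ≤ N := le_trans (le_trans (le_max_right _ _) (le_max_right _ _)) hN
  have hNpos : 0 < N := lt_of_lt_of_le hN₀1 hNN₀
  -- a Weil datum at level `2^N`
  have hp2 : 2 ≤ 2 ^ N := le_trans (by norm_num) (Nat.pow_le_pow_right (by norm_num) hNpos)
  have hchar : ((2 ^ N : ℕ) : K) ≠ 0 := Nat.cast_ne_zero.mpr (pow_ne_zero _ two_ne_zero)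
  obtain ⟨ε, hμ, hadd₁, hadd₂, halt, hnondeg, hgal⟩ := (W.baseChange K).exists_weilPairing_holds (2 ^ N) hp2 hchar
  -- the isotropic level splitting
  obtain ⟨eN, eN', heN, -, hsumN, -, -, -, -, hiso, hiso'⟩ :=
    exists_isotropic_levelSplitting_of_frame W hj K hθ π hrel hr e e' he₁ he he'₁ he' hsum N ε hμ hadd₁ hadd₂ halt
  refine ⟨eN, heN, fun 𝓕 h𝓕inf h𝓕 h𝓕v ↦ ?_⟩
  -- (P1)-lift: `relIndex = #range(res_{D_v} | 𝔖_v̄)`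
  rw [relIndex_selmerGroup_update_top_eq_natCard_range_resOfLe (W.baseChange K) 2 π r N e he he₁ eN heN hv hne hall (hN₀ N hNN₀) 𝓕
    h𝓕inf h𝓕 h𝓕v]
  -- pinning at level `N` (local) and at level `N + cb` (lifted point classes)
  obtain ⟨hαN, -⟩ := hPIN d hd0 hsq hd4 W C hC hrk K hK v vbar hv hvbar hne π hrel r hr hpinI P c₀ ℓ hP hgen hc₀ hker hlog hfin
    e he₁ he0 he N eN heN
  obtain ⟨eNc, -, heNc, -⟩ := exists_levelProj (W.baseChange K) 2 π r (N + cb) e he₁ he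
  obtain ⟨-, hpinNc⟩ := hPIN d hd0 hsq hd4 W C hC hrk K hK v vbar hv hvbar hne π hrel r hr hpinI P c₀ ℓ hP hgen hc₀ hker hlog hfin
    e he₁ he0 he (N + cb) eNc heNc
  -- `#range = [E(K_v) : E(K) + 2^N E(K_v)]`
  rw [natCard_range_resOfLe_restrictedSelmerBase_eq_index (W.baseChange K) 2 π r N e he he₁ ε hμ hadd₁ hadd₂ hgal halt hnondeg eN eN'
    heN hsumN hiso hiso' hNpos (Summit.BirchSwinnertonDyer.BirchSwinnertonDyer.Theorems.SchneiderFreeAdditiveX3.PoitouTateReduction.poitouTate_selmerStructure_duality_holds K) hv hne hall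
    (hN₀ N hNN₀) hαN (j := j) (by omega) (hShaj N) (hcv (N - j) N (by omega)) (fun R ↦ hcb (N + cb) R) hpinNc]
  exact hN₃ N hNN₃

end Cut

end Summit.BirchSwinnertonDyer.BirchSwinnertonDyer.Theorems.PrintCf2.SelmerLocImage

end
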